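import Literature.Computability.FineGrained.Sweep1OVBridge
import Literature.Computability.FineGrained.Sweep1OVRun
import Literature.Computability.FineGrained.CliqueETHGroupingReduction
import HarnessLib

/-!
# Proof of the win-win theorem `ethr2_lower_bound_or_ov_almost_linear` (fine-grained.S26)

(File name: the companion `Sweep1Proofs.lean` records the status of `ethr2_lower_bound_of_seth`;
this file holds the discharge of the disjunction itself.)

Discharge of the named fact `Literature.Computability.FineGrained.ethr2_lower_bound_or_ov_almost_linear`
of `…FineGrained.Sweep1` (R. Williams, *The Orthogonal Vectors Conjecture and Non-Uniform Circuit
Lower Bounds*, FOCS 2024; full version ECCC TR24-142, main theorem of the abstract = Cor. 1 with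
Thms. 2, 3, 8, 10): **either** for some `ε > 0` and infinitely many `m` the read-once 2-DNF on `2m`
variables has no depth-two exact threshold circuit of size `2^{ε · 2m}` (`EThr2LowerBound`), **or**
for every `c ≥ 1` and `ε > 0` Orthogonal Vectors with `d = c ⌊log₂ n⌋` is in deterministic
word-RAM time `O(n^{1+ε})` (`OVAlmostLinear`).

The proof follows the paper. If the lower bound fails, then for every `δ > 0` all sufficiently
large read-once 2-DNFs have `ETHR ∘ ETHR` circuits of size `2^{δ · 2m}`; by Thm. 2 in the prelude
model and the sum of squares (`exists_isPosDisj_of_hasEThr2CircuitOfSize`, file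
`…Sweep1EqualityRank`) this gives, for every `ρ > 0`, a block length `kb` and a *positive* equality
representation of `2^{kb} × 2^{kb}` Disjointness with `r ≤ 2^{ρ kb}` terms
(`exists_rep_of_forall_circuits`, the uniformization of Thm. 8: one constant-size representation,
hard-coded as the tables of the program). The word-RAM program of that representation
(`OVEq.prog`, files `…Sweep1OVProgram`, `…Sweep1OVMainLoop`; Thm. 10 with the Kronecker power of
Thm. 8 and equal-key counting by direct addressing) decides OV (`outBit_ofRep`, file
`…Sweep1OVBridge`), at word size `kfit · inputWidth` (`fits`, file `…Sweep1OVRun`), in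
`Ttotal + 1 ≤ O(r^K n K)` steps (`Ttotal_le`); with `ρ = ε/(2c)` one has `r^K ≤ r (n+1)^{ε/2}`
(`pow_blocks_le`, the computation `(2^{ε′k})^{d/k} ≤ 2^{ε′d} = n^{ε/2}` of the proof of Thm. 3) and
`K ≤ c ⌊log₂ n⌋ = O((n+1)^{ε/4})` (`exists_log_le_rpow`), whence time `≤ C n^{1+ε} + C`
(`Ttotal_real_le`, `ovAlmostLinear_of_forall_circuits`). The corollary
`ethr2_lower_bound_of_ovConjectureDet` of `Sweep1.lean` is discharged as well (its preserved interim
proof).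

## References

* R. Williams, *The Orthogonal Vectors Conjecture and Non-Uniform Circuit Lower Bounds*, FOCS 2024,
  1372–1387; ECCC TR24-142 (2024), abstract, §1 Cor. 1, §2 Thm. 2, §3 Thms. 8, 10, 3, §4.
-/

namespace Literature.Computability.FineGrained

open Cryptography Cryptography.WordRAM Complexity Cryptography.WordRAM.SProg

/-! ## The win-win theorem -/

section analysis

open Filter OVEq

/-- `⌊log₂ n⌋ + 1 ≤ C (n + 1)^η`: logarithms are dominated by every power. [folklore] -/
theorem exists_log_le_rpow {η : ℝ} (hη : 0 < η) :
    ∃ C : ℝ, 1 ≤ C ∧ ∀ n : ℕ, (Nat.log 2 n : ℝ) + 1 ≤ C * ((n : ℝ) + 1) ^ η := by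
  obtain ⟨C, hC0, hC⟩ := CliqueRed.exists_sq_le_two_rpow hη
  refine ⟨max C 1, le_max_right _ _, fun n => ?_⟩
  set m := Nat.log 2 n with hm
  have h1 : (m : ℝ) + 1 ≤ ((m : ℝ) + 1) ^ 2 := by
    have : (0 : ℝ) ≤ m := Nat.cast_nonneg m
    nlinarith
  have h2m : (2 : ℝ) ^ (m : ℝ) ≤ (n : ℝ) + 1 := by
    rw [Real.rpow_natCast]; exact_mod_cast Nat.pow_log_le_add_one 2 n
  have h3 : (2 : ℝ) ^ (η * m) ≤ ((n : ℝ) + 1) ^ η := by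
    rw [mul_comm, Real.rpow_mul (by norm_num)]
    exact Real.rpow_le_rpow (by positivity) h2m hη.le
  calc (m : ℝ) + 1 ≤ ((m : ℝ) + 1) ^ 2 := h1
    _ ≤ C * (2 : ℝ) ^ (η * m) := hC m
    _ ≤ C * ((n : ℝ) + 1) ^ η := by gcongr
    _ ≤ max C 1 * ((n : ℝ) + 1) ^ η := by gcongr; exact le_max_left _ _

/-- **`r^K` is a small power of `n`** when `r ≤ 2^{ρ k}`, `K = ⌈d/k⌉` and `d = c ⌊log₂ n⌋`:
`r^K ≤ r · (n + 1)^{ρ c}` (Williams, ECCC TR24-142, proof of Thm. 3: "`(2^{ε'k})^{d/k} ≤ 2^{ε' d}`").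
[cite: Williams2024, Thm. 3 (proof)] -/
theorem pow_blocks_le {kb r c d n : ℕ} (hr1 : 1 ≤ r) (hkb : 1 ≤ kb) {ρ : ℝ} (hρ : 0 ≤ ρ)
    (hrρ : (r : ℝ) ≤ (2 : ℝ) ^ (ρ * kb)) (hd : d = c * Nat.log 2 n) :
    ((r ^ ((d + (kb - 1)) / kb) : ℕ) : ℝ) ≤ r * ((n : ℝ) + 1) ^ (ρ * c) := by
  set m := Nat.log 2 n with hm
  have hK : (d + (kb - 1)) / kb ≤ d / kb + 1 := by
    calc (d + (kb - 1)) / kb ≤ (d + kb) / kb := Nat.div_le_div_right (by omega)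
      _ = d / kb + 1 := Nat.add_div_right _ (by omega)
  have h1 : r ^ ((d + (kb - 1)) / kb) ≤ r ^ (d / kb + 1) := Nat.pow_le_pow_right hr1 hK
  have h2 : ((r ^ (d / kb) : ℕ) : ℝ) ≤ (2 : ℝ) ^ (ρ * d) := by
    have hq : (kb : ℝ) * (d / kb : ℕ) ≤ d := by exact_mod_cast Nat.mul_div_le d kb
    calc ((r ^ (d / kb) : ℕ) : ℝ) = (r : ℝ) ^ ((d / kb : ℕ) : ℝ) := by
          rw [Real.rpow_natCast]; push_cast; rfl
      _ ≤ ((2 : ℝ) ^ (ρ * kb)) ^ ((d / kb : ℕ) : ℝ) :=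
          Real.rpow_le_rpow (Nat.cast_nonneg _) hrρ (Nat.cast_nonneg _)
      _ = (2 : ℝ) ^ (ρ * (kb * (d / kb : ℕ))) := by rw [← Real.rpow_mul (by norm_num)]; ring_nf
      _ ≤ (2 : ℝ) ^ (ρ * d) := by
          apply Real.rpow_le_rpow_of_exponent_le one_le_two
          exact mul_le_mul_of_nonneg_left hq hρ
  have h3 : (2 : ℝ) ^ (ρ * d) ≤ ((n : ℝ) + 1) ^ (ρ * c) := by
    have h2m : (2 : ℝ) ^ (m : ℝ) ≤ (n : ℝ) + 1 := by
      rw [Real.rpow_natCast]; exact_mod_cast Nat.pow_log_le_add_one 2 n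
    rw [hd]; push_cast
    rw [show ρ * (c * (m : ℝ)) = (m : ℝ) * (ρ * c) by ring, Real.rpow_mul (by norm_num)]
    exact Real.rpow_le_rpow (by positivity) h2m (by positivity)
  calc ((r ^ ((d + (kb - 1)) / kb) : ℕ) : ℝ) ≤ ((r ^ (d / kb + 1) : ℕ) : ℝ) := by exact_mod_cast h1
    _ = r * ((r ^ (d / kb) : ℕ) : ℝ) := by push_cast; ring
    _ ≤ r * (2 : ℝ) ^ (ρ * d) := by gcongr
    _ ≤ r * ((n : ℝ) + 1) ^ (ρ * c) := by gcongr

/-- Powers of `n + 1` against powers of `n`: `(n + 1)^p ≤ 2^p (n^p + 1)` for `p ≥ 0`. [folklore] -/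
theorem succ_rpow_le (n : ℕ) {p : ℝ} (hp : 0 ≤ p) :
    ((n : ℝ) + 1) ^ p ≤ (2 : ℝ) ^ p * ((n : ℝ) ^ p + 1) := by
  rcases Nat.eq_zero_or_pos n with rfl | hn
  · simp only [Nat.cast_zero, zero_add, Real.one_rpow]
    have : (1 : ℝ) ≤ 2 ^ p := Real.one_le_rpow one_le_two hp
    have h0 : (0 : ℝ) ^ p + 1 ≥ 1 := by
      have : (0 : ℝ) ≤ (0 : ℝ) ^ p := Real.rpow_nonneg le_rfl p
      linarith
    nlinarith
  · have hn1 : (1 : ℝ) ≤ n := by exact_mod_cast hn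
    calc ((n : ℝ) + 1) ^ p ≤ (2 * (n : ℝ)) ^ p :=
          Real.rpow_le_rpow (by positivity) (by linarith) hp
      _ = (2 : ℝ) ^ p * (n : ℝ) ^ p := Real.mul_rpow (by norm_num) (by positivity)
      _ ≤ (2 : ℝ) ^ p * ((n : ℝ) ^ p + 1) := by
          have : (0 : ℝ) ≤ 2 ^ p := by positivity
          nlinarith


/-- A positive representation has at least one term. [folklore] -/
theorem _root_.Literature.Computability.FineGrained.EqRep.IsPosDisj.one_le_r {k r : ℕ} {R : EqRep k r}
    (hR : R.IsPosDisj) : 1 ≤ r := by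
  have h := (hR.pos_iff (fun _ => false) (fun _ => false)).2 (fun i hi => by simp at hi)
  unfold EqRep.eval at h
  rcases Nat.eq_zero_or_pos r with hr | hr
  · subst hr; simp at h
  · exact hr

/-- **Uniformization (Williams, ECCC TR24-142, Thm. 8 with Thm. 2 and the sum of squares of
Thm. 10).** If for every `δ > 0` all sufficiently large read-once 2-DNFs have depth-two exact
threshold circuits of size `2^{δ · 2m}`, then for every `ρ > 0` there are a block length `kb ≥ 1`
and a positive representation of `2^{kb} × 2^{kb}` Disjointness with `r ≤ 2^{ρ kb}` terms.
[cite: Williams2024, Thm. 8] -/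
theorem exists_rep_of_forall_circuits
    (hall : ∀ δ : ℝ, 0 < δ → ∀ᶠ m : ℕ in atTop, HasEThr2CircuitOfSize m ((2 : ℝ) ^ (δ * (2 * m))))
    {ρ : ℝ} (hρ : 0 < ρ) :
    ∃ (kb r : ℕ) (R : EqRep kb r), 1 ≤ kb ∧ 1 ≤ r ∧ R.IsPosDisj ∧ (r : ℝ) ≤ (2 : ℝ) ^ (ρ * kb) := by
  set δ : ℝ := ρ / 8 with hδ
  have hδ0 : 0 < δ := by positivity
  obtain ⟨C, hC0, hC⟩ := CliqueRed.exists_sq_le_two_rpow hδ0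
  have E1 := hall δ hδ0
  have E2 : ∀ᶠ m : ℕ in atTop, 1 / δ ≤ (m : ℝ) :=
    tendsto_natCast_atTop_atTop.eventually_ge_atTop _
  have E3 : ∀ᶠ m : ℕ in atTop, C ≤ (m : ℝ) :=
    tendsto_natCast_atTop_atTop.eventually_ge_atTop _
  have E4 : ∀ᶠ m : ℕ in atTop, 1 ≤ m := eventually_ge_atTop 1
  obtain ⟨kb, hcirc, hkb2, hkb3, hkb1⟩ := (E1.and (E2.and (E3.and E4))).exists
  obtain ⟨r, R, hr, hR⟩ := exists_isPosDisj_of_hasEThr2CircuitOfSize hcirc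
  refine ⟨kb, r, R, hkb1, hR.one_le_r, hR, ?_⟩
  -- the size bound
  have hkb0 : (0 : ℝ) < kb := by exact_mod_cast hkb1
  set σ : ℝ := (2 : ℝ) ^ (δ * kb) with hσ
  have hσ1 : (1 : ℝ) ≤ δ * kb := by
    rw [div_le_iff₀ hδ0] at hkb2; linarith
  have hσ2 : (2 : ℝ) ≤ σ := by
    calc (2 : ℝ) = 2 ^ (1 : ℝ) := (Real.rpow_one 2).symm
      _ ≤ 2 ^ (δ * kb) := Real.rpow_le_rpow_of_exponent_le one_le_two hσ1
  have hkbσ : (kb : ℝ) + 1 ≤ σ := by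
    have h1 := hC kb
    have h2 : C * (2 : ℝ) ^ (δ * kb) ≤ ((kb : ℝ) + 1) * σ := by
      rw [hσ]; gcongr; linarith
    have h3 : ((kb : ℝ) + 1) ^ 2 ≤ ((kb : ℝ) + 1) * σ := h1.trans h2
    nlinarith
  have h22 : (2 : ℝ) ^ (δ * (2 * kb)) = σ * σ := by
    rw [show δ * (2 * (kb : ℝ)) = δ * kb + δ * kb by ring, Real.rpow_add (by norm_num)]
  have hbase : (2 : ℝ) ^ (δ * (2 * kb)) + 2 * kb + 1 ≤ 2 * (σ * σ) := by
    rw [h22]; nlinarith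
  have hsq : ((2 : ℝ) ^ (δ * (2 * kb)) + 2 * kb + 1) ^ 2 ≤ 4 * (σ * σ) ^ 2 := by
    have h0 : (0 : ℝ) ≤ (2 : ℝ) ^ (δ * (2 * kb)) + 2 * kb + 1 := by positivity
    nlinarith
  have h4 : (4 : ℝ) ≤ σ * σ := by nlinarith
  have hfin : 4 * (σ * σ) ^ 2 ≤ (2 : ℝ) ^ (ρ * kb) := by
    have e : (2 : ℝ) ^ (ρ * kb) = σ ^ (8 : ℕ) := by
      rw [hσ, ← Real.rpow_natCast, ← Real.rpow_mul (by norm_num)]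
      congr 1; rw [hδ]; push_cast; ring
    rw [e, show σ ^ (8 : ℕ) = (σ * σ) ^ 2 * ((σ * σ) ^ 2) by ring]
    have h16 : (16 : ℝ) ≤ (σ * σ) ^ 2 := by nlinarith
    have h0 : (0 : ℝ) ≤ (σ * σ) ^ 2 := by positivity
    nlinarith
  calc (r : ℝ) ≤ ((2 : ℝ) ^ (δ * (2 * kb)) + 2 * kb + 1) ^ 2 := hr
    _ ≤ 4 * (σ * σ) ^ 2 := hsq
    _ ≤ (2 : ℝ) ^ (ρ * kb) := hfin


/-- **The running time in the regime `d = c ⌊log₂ n⌋`** (Williams, ECCC TR24-142, proof of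
Thm. 3): with `r ≤ 2^{(ε/2c) kb}` terms, the program of the representation runs in time
`O(n^{1+ε})` — explicitly, at most `D · (n^{1+ε} + 1) + (2 tsz + 67)` steps with
`D = 2^{1+ε} ((34c + 9) C + 32 r c C)`, `C` the constant of `⌊log₂ n⌋ + 1 ≤ C (n+1)^{ε/4}`.
[cite: Williams2024, Thm. 3 (proof)] -/
theorem Ttotal_real_le {kb r : ℕ} (R : EqRep kb r) (hkb : 1 ≤ kb) (hr1 : 1 ≤ r) {c : ℕ}
    (hc : 1 ≤ c) {ε : ℝ} (hε : 0 < ε) (hrρ : (r : ℝ) ≤ (2 : ℝ) ^ (ε / (2 * c) * kb))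
    {Cη : ℝ} (hCη1 : 1 ≤ Cη) (hlog : ∀ n : ℕ, (Nat.log 2 n : ℝ) + 1 ≤ Cη * ((n : ℝ) + 1) ^ (ε / 4))
    (I : OVInstance) (hI : I.d = c * Nat.log 2 I.n) :
    (((Params.ofRep R I).Ttotal + 1 : ℕ) : ℝ) ≤
      (2 : ℝ) ^ (1 + ε) * ((34 * c + 9) * Cη + 32 * r * c * Cη) * ((I.n : ℝ) ^ (1 + ε) + 1) +
        (2 * (R.tablesOf.tsz : ℝ) + 67) := by
  set g : Params := Params.ofRep R I with hg
  have hc0 : (0 : ℝ) < c := by exact_mod_cast hc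
  have hc1 : (1 : ℝ) ≤ c := by exact_mod_cast hc
  have hr0 : (0 : ℝ) ≤ r := Nat.cast_nonneg r
  -- the natural bound and the shape facts
  have hT := g.Ttotal_le
  have hL : g.L = 2 + 2 * (g.n * g.d) := g.L_eq
  have hKd : g.K ≤ g.d := g.K_le_d hkb
  have hgn : g.n = I.n := rfl
  have hgd : g.d = I.d := rfl
  set n := I.n with hn
  set m := Nat.log 2 n with hm
  have hdm : g.d = c * m := by rw [hgd, hI]
  -- the powers
  set P : ℝ := (n : ℝ) + 1 with hP
  have hP1 : (1 : ℝ) ≤ P := by rw [hP]; have := Nat.cast_nonneg (α := ℝ) n; linarith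
  have hP0 : (0 : ℝ) < P := by linarith
  set Λ : ℝ := Cη * P ^ (ε / 4) with hΛ
  have hmΛ : (m : ℝ) + 1 ≤ Λ := hlog n
  have hΛ0 : (0 : ℝ) ≤ Λ := by have := Nat.cast_nonneg (α := ℝ) m; linarith
  have hRK : ((g.RK : ℕ) : ℝ) ≤ r * P ^ (ε / 2) := by
    have := pow_blocks_le (n := n) hr1 hkb (ρ := ε / (2 * c)) (by positivity) hrρ hdm
    have e : ε / (2 * c) * c = ε / 2 := by field_simp
    rw [e] at this
    exact this
  set Q : ℝ := P ^ (1 + 3 * ε / 4) with hQ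
  have hQexp : ∀ a : ℝ, a ≤ 1 + 3 * ε / 4 → P ^ a ≤ Q := fun a ha =>
    Real.rpow_le_rpow_of_exponent_le hP1 ha
  have hPQ : P ≤ Q := by simpa using hQexp 1 (by linarith)
  have hεQ : P ^ (ε / 4) ≤ Q := hQexp _ (by linarith)
  have hPΛQ : P * P ^ (ε / 4) ≤ Q := by
    have : P * P ^ (ε / 4) = P ^ (1 + ε / 4) := by
      rw [Real.rpow_add hP0, Real.rpow_one]
    rw [this]; exact hQexp _ (by linarith)
  have hmainQ : P ^ (ε / 2) * P * P ^ (ε / 4) = Q := by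
    rw [hQ, show (1 : ℝ) + 3 * ε / 4 = ε / 2 + 1 + ε / 4 by ring, Real.rpow_add hP0,
      Real.rpow_add hP0, Real.rpow_one]
  have hQ0 : (0 : ℝ) ≤ Q := by positivity
  -- casting the natural bound
  have cT : ((g.Ttotal + 1 : ℕ) : ℝ) ≤ 15 * (g.L : ℝ) + 2 * R.tablesOf.tsz + 9 * n + 4 * g.K + 37 +
      32 * ((g.RK : ℝ) * ((n + 1) * ((g.K : ℝ) + 1))) := by
    have := hT; rw [hgn] at this; exact_mod_cast this
  have cL : (g.L : ℝ) = 2 + 2 * (n * (c * m)) := by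
    rw [hL, hgn, hdm]; push_cast; ring
  have cK : (g.K : ℝ) ≤ c * m := by rw [← Nat.cast_mul, ← hdm]; exact_mod_cast hKd
  have hnP : (n : ℝ) ≤ P := by linarith
  have hmΛ' : (m : ℝ) ≤ Λ := by linarith
  -- term by term
  have t1 : 15 * (g.L : ℝ) ≤ 30 + 30 * c * Cη * Q := by
    rw [cL]
    have h1 : (n : ℝ) * (c * m) ≤ P * (c * Λ) := by
      apply mul_le_mul hnP _ (by positivity) (by linarith)
      exact mul_le_mul_of_nonneg_left hmΛ' hc0.le
    have h2 : P * (c * Λ) = c * Cη * (P * P ^ (ε / 4)) := by rw [hΛ]; ring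
    have h3 : c * Cη * (P * P ^ (ε / 4)) ≤ c * Cη * Q := by gcongr
    linarith
  have t2 : 9 * (n : ℝ) ≤ 9 * Q := by linarith
  have t3 : 4 * (g.K : ℝ) ≤ 4 * c * Cη * Q := by
    have h1 : (c : ℝ) * m ≤ c * Λ := mul_le_mul_of_nonneg_left hmΛ' hc0.le
    have h2 : (c : ℝ) * Λ = c * Cη * P ^ (ε / 4) := by rw [hΛ]; ring
    have h3 : c * Cη * P ^ (ε / 4) ≤ c * Cη * Q := by gcongr
    linarith
  have t4 : 32 * ((g.RK : ℝ) * ((n + 1) * ((g.K : ℝ) + 1))) ≤ 32 * r * c * Cη * Q := by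
    have hK1 : (g.K : ℝ) + 1 ≤ c * Λ := by
      calc (g.K : ℝ) + 1 ≤ c * m + 1 := by linarith
        _ ≤ c * ((m : ℝ) + 1) := by nlinarith
        _ ≤ c * Λ := mul_le_mul_of_nonneg_left hmΛ hc0.le
    have h1 : (g.RK : ℝ) * ((n + 1) * ((g.K : ℝ) + 1)) ≤ (r * P ^ (ε / 2)) * (P * (c * Λ)) := by
      apply mul_le_mul hRK _ (by positivity) (by positivity)
      exact mul_le_mul_of_nonneg_left hK1 hP0.le
    have h2 : (r * P ^ (ε / 2)) * (P * (c * Λ)) = r * c * Cη * (P ^ (ε / 2) * P * P ^ (ε / 4)) := by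
      rw [hΛ]; ring
    rw [hmainQ] at h2
    linarith
  -- assemble
  have hQP : Q ≤ (2 : ℝ) ^ (1 + ε) * ((n : ℝ) ^ (1 + ε) + 1) := by
    calc Q ≤ P ^ (1 + ε) := Real.rpow_le_rpow_of_exponent_le hP1 (by linarith)
      _ ≤ (2 : ℝ) ^ (1 + ε) * ((n : ℝ) ^ (1 + ε) + 1) := succ_rpow_le n (by linarith)
  have hcoef : (0 : ℝ) ≤ (34 * c + 9) * Cη + 32 * r * c * Cη := by positivity
  calc ((g.Ttotal + 1 : ℕ) : ℝ)
      ≤ 15 * (g.L : ℝ) + 2 * R.tablesOf.tsz + 9 * n + 4 * g.K + 37 +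
          32 * ((g.RK : ℝ) * ((n + 1) * ((g.K : ℝ) + 1))) := cT
    _ ≤ (30 + 30 * c * Cη * Q) + 2 * R.tablesOf.tsz + 9 * Q + 4 * c * Cη * Q + 37 +
          32 * r * c * Cη * Q := by linarith
    _ = ((34 * c) * Cη + 32 * r * c * Cη) * Q + 9 * Q + (2 * R.tablesOf.tsz + 67) := by ring
    _ ≤ ((34 * c + 9) * Cη + 32 * r * c * Cη) * Q + (2 * R.tablesOf.tsz + 67) := by nlinarith
    _ ≤ ((34 * c + 9) * Cη + 32 * r * c * Cη) * ((2 : ℝ) ^ (1 + ε) * ((n : ℝ) ^ (1 + ε) + 1)) +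
          (2 * R.tablesOf.tsz + 67) := by gcongr
    _ = _ := by ring

/-- **Theorem 3 of Williams (ECCC TR24-142), with Thm. 2: small depth-two exact threshold circuits
for all densities give almost-linear OV algorithms.** If for every `δ > 0` all sufficiently large
read-once 2-DNFs on `2m` variables have `ETHR ∘ ETHR` circuits of size `2^{δ · 2m}`, then for every
`c ≥ 1` and `ε > 0`, OV with `d = c ⌊log₂ n⌋` is in deterministic word-RAM time `O(n^{1+ε})`.
[cite: Williams2024, Thm. 3] -/
theorem ovAlmostLinear_of_forall_circuits
    (hall : ∀ δ : ℝ, 0 < δ → ∀ᶠ m : ℕ in atTop, HasEThr2CircuitOfSize m ((2 : ℝ) ^ (δ * (2 * m)))) :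
    OVAlmostLinear := by
  intro c hc ε hε
  have hc0 : (0 : ℝ) < c := by exact_mod_cast hc
  have hρ : 0 < ε / (2 * c) := by positivity
  obtain ⟨kb, r, R, hkb, hr1, hR, hrρ⟩ := exists_rep_of_forall_circuits hall hρ
  obtain ⟨Cη, hCη1, hlog⟩ := exists_log_le_rpow (η := ε / 4) (by positivity)
  have htb : R.tablesOf.WF := R.tablesOf_WF hkb hR.one_le_bound
  set D : ℝ := (2 : ℝ) ^ (1 + ε) * ((34 * c + 9) * Cη + 32 * r * c * Cη) with hD
  set CT : ℝ := D + (2 * (R.tablesOf.tsz : ℝ) + 67) with hCT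
  have hD0 : 0 ≤ D := by positivity
  refine ⟨CT, (prog R.tablesOf).toProgram, Params.kfit R.tablesOf c, toProgram_isDeterministic _,
    toProgram_isOracleFree (prog_queryFree _), fun a => ?_⟩
  obtain ⟨I, hI⟩ := a
  have hI' : I.d = c * Nat.log 2 I.n := hI
  set g : Params := Params.ofRep R I with hg
  have hF : g.Fits (Params.kfit R.tablesOf c * inputWidth g.x) := g.fits htb (le_of_eq hI')
  have hrun := g.prog_outputsWithin (O := noOracle) hF htb zeroCoins
  have hout : g.outBit = if I.HasOrthogonalPair then 1 else 0 := Params.outBit_ofRep R I hkb hR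
  refine ⟨[g.outBit], ?_, hrun.mono ?_⟩
  · show [g.outBit] ∈ OV.Good I
    rw [hout]
    by_cases h : OVInstance.HasOrthogonalPair I
    · have e : OV.Good I = {[1]} :=
        FGProblem.ofPred_good_of_pos OVInstance.encode (fun J : OVInstance => J.n)
          OVInstance.HasOrthogonalPair I h
      rw [e, if_pos h]; exact Set.mem_singleton _
    · have e : OV.Good I = {[0]} :=
        FGProblem.ofPred_good_of_neg OVInstance.encode (fun J : OVInstance => J.n)
          OVInstance.HasOrthogonalPair I h
      rw [e, if_neg h]; exact Set.mem_singleton _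
  · apply Nat.le_floor
    have hT := Ttotal_real_le R hkb hr1 hc hε hrρ hCη1 hlog I hI'
    show ((g.Ttotal + 1 : ℕ) : ℝ) ≤ CT * ((I.n : ℕ) : ℝ) ^ (1 + ε) + CT
    have hn0 : (0 : ℝ) ≤ (I.n : ℝ) ^ (1 + ε) := by positivity
    have htsz : (0 : ℝ) ≤ 2 * (R.tablesOf.tsz : ℝ) + 67 := by positivity
    calc ((g.Ttotal + 1 : ℕ) : ℝ) ≤ D * ((I.n : ℝ) ^ (1 + ε) + 1) + (2 * (R.tablesOf.tsz : ℝ) + 67) := hT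
      _ = D * (I.n : ℝ) ^ (1 + ε) + (D + (2 * R.tablesOf.tsz + 67)) := by ring
      _ ≤ CT * (I.n : ℝ) ^ (1 + ε) + CT := by rw [hCT]; nlinarith

end analysis

/-- **fine-grained.S26 discharged** (R. Williams, *The Orthogonal Vectors Conjecture and
Non-Uniform Circuit Lower Bounds*, FOCS 2024 / ECCC TR24-142, main theorem of the abstract = the
case split of Cor. 1 with Thms. 2, 8, 10 and 3): either read-once 2-DNFs need depth-two exact
threshold circuits of size `2^{εn}` infinitely often, or OV in `c log n` dimensions is in
`n^{1+ε}` time for all `c, ε`. Proof: if the lower bound fails, then for every `δ > 0` all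
sufficiently large read-once 2-DNFs have `ETHR ∘ ETHR` circuits of size `2^{δ · 2m}`
(`Filter.not_eventually`), and `ovAlmostLinear_of_forall_circuits` applies. [cite: Williams2024, Cor. 1 and Thm. 3] -/
theorem ethr2_lower_bound_or_ov_almost_linear_holds : ethr2_lower_bound_or_ov_almost_linear := by
  by_cases h : EThr2LowerBound
  · exact Or.inl h
  · refine Or.inr (ovAlmostLinear_of_forall_circuits fun δ hδ => ?_)
    by_contra hne
    exact h ⟨δ, hδ, Filter.not_eventually.mp hne⟩

/-- **fine-grained.S26, win-win corollary, discharged**: the deterministic OV conjecture implies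
the depth-two exact threshold lower bound for read-once 2-DNFs (the preserved interim proof of
`Sweep1.lean`, now fed with `ethr2_lower_bound_or_ov_almost_linear_holds`). [cite: Williams2024, Cor. 1] -/
theorem ethr2_lower_bound_of_ovConjectureDet_holds : ethr2_lower_bound_of_ovConjectureDet :=
  fun h => ethr2_lower_bound_or_ov_almost_linear_holds.resolve_right
    fun h' => not_ovConjectureDet_of_ovAlmostLinear h' h

end Literature.Computability.FineGrained
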